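import Summits.NavierStokesRegularity.NavierStokesRegularity.Theorems.ExtremiserTransienceKStarAttainedVariation
import Summits.NavierStokesRegularity.NavierStokesRegularity.Theorems.ExtremiserTransienceKStarAttainedConePotential
import Summits.NavierStokesRegularity.NavierStokesRegularity.Theorems.ExtremiserTransienceKStarAttainedDensity
import HarnessLib

/-!
# Route `ExtremiserTransience`, support item `KStarAttained` (stmt-NavierStokesRegularity-24370):
# A SMOOTH ATTAINER OF `κ⋆` SATURATES `|v| = M` ON AN OPEN SET; NO REAL-ANALYTIC ATTAINER

`--supports stmt-NavierStokesRegularity-24370`. Author: prover seat `ns-et-p1` (g3).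

Let `(v, M, B)` be admissible (`C^∞`, divergence free, `‖v‖ ≤ M`, `‖Dv‖ ≤ B`, `D⁰v, D¹v, D²v ∈ L²`),
non-degenerate (`M‖ω‖₂‖∇ω‖₂ > 0`) and suppose it ATTAINS the sharp depletion constant:
`|∫⟪ω, Dv ω⟫| = κ⋆·M·‖ω‖₂·‖∇ω‖₂`, `κ⋆ = sInf V` — i.e. `(v, M, B)` witnesses the item `KStarAttained`.

Ingredients (landed): the Euler–Lagrange identities `firstVariation_eq_zero_offContact` /
`firstVariation_eq_of_normBound` (`…KStarAttainedVariation`), the continuous density `G` of the first-variation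
functional on curls (`…KStarAttainedDensity.exists_density` — where `C^∞`-smoothness of `v` enters), and the
divergence-free cut-off `curl (χ·conePotential v)` with its norm bound (`…KStarAttainedConePotential`).
* `KStar.interior_contact_nonempty` — **the contact set `{x : ‖v x‖ = M}` of an attainer has NONEMPTY
  INTERIOR.** Proof: if it were nowhere dense, the Euler–Lagrange identity off the contact set
  (`firstVariation_eq_zero_offContact`) says `∫⟪G, η⟫ = 0` for all `η` supported in the dense open set
  `{‖v‖ < M}`, so the continuous `G` vanishes there, hence everywhere, hence `ℓ(curl η) = 0` for EVERY
  `η ∈ C^∞_c`; but for the divergence-free cut-off `φ_R = curl (χ·conePotential v)`, which equals `v` on a ball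
  outside of which `‖v‖ < M/2` (`…KStarAttainedConePotential`), the norm bound `‖v + εφ_R‖ ≤ (1+ε)M` and
  `firstVariation_eq_of_normBound` (`m = 1`) give `ℓ(φ_R) = κ⋆²·M²·Z·W > 0` (`κ⋆ > 13/200`). Contradiction.
  So an extremiser must be "bang-bang": `|v| ≡ sup|v|` on an open set (a plateau of the speed).
* `KStar.not_attained_of_analyticOnNhd` — **no real-analytic admissible field attains `κ⋆`**: on the plateau
  `‖v‖² ≡ M²`, so by the identity principle `‖v‖ ≡ M > 0` on `ℝ³`, contradicting `v → 0` at infinity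
  (`v ∈ L²`, Lipschitz). In particular the tree's polynomial-Gaussian witnesses (`depletion_constant_witness`,
  the `Q5`/Lamb-split fields) and every finite combination of such fields are NOT extremal.

What remains for the item (recorded, not claimed): attainment would require a `C^∞` but non-analytic field
whose speed is constant on an open set and which solves a free-boundary problem across the plateau boundary;
non-attainment would require excluding such plateau extremisers (or a concentration-compactness analysis of
maximising sequences). Neither is asserted. NS regularity is NOT proved by anything here. [folklore]
-/

noncomputable section

open Set Filter Topology MeasureTheory Metric
open scoped InnerProductSpace RealInnerProductSpace ENNReal NNReal ContDiff Laplacian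
open Literature.Analysis.FluidPDE

namespace Summit.NavierStokesRegularity.NavierStokesRegularity.Theorems

-- the problem directory repeats the summit name (`NavierStokesRegularity/NavierStokesRegularity`)
set_option linter.dupNamespace false

namespace DepletionLadder.KStar

variable {v : EuclideanSpace ℝ (Fin 3) → EuclideanSpace ℝ (Fin 3)}

/-! ## The contact set of an attainer has nonempty interior -/

/-- **A SMOOTH ATTAINER OF `κ⋆` HAS A PLATEAU: the contact set `{x : ‖v x‖ = M}` has nonempty interior.**
Let `(v, M, B)` be admissible, non-degenerate (`M‖ω‖₂‖∇ω‖₂ > 0`) and attain the sharp depletion constant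
`κ⋆ = sInf V`: `|∫⟪ω, Dv ω⟫| = κ⋆·M·‖ω‖₂·‖∇ω‖₂`. Then `|v| ≡ M` on some nonempty open set. (If the
contact set were nowhere dense: the first-variation density `G` of
`ℓ(φ) = J·J₁(φ) − κ⋆²M²(W·a₁(φ) + Z·c₁(φ))` vanishes on the dense open set `{‖v‖ < M}` by the
Euler–Lagrange identity off the contact set, hence everywhere by continuity, so `ℓ(curl η) = 0` for all
`η ∈ C^∞_c`; but the divergence-free cut-off `φ_R = curl (χ·conePotential v)`, `= v` on a ball off which
`‖v‖ < M/2`, obeys `‖v + εφ_R‖ ≤ (1+ε)M` and hence `ℓ(φ_R) = κ⋆²·M²·Z·W > 0`.) [folklore] -/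
theorem interior_contact_nonempty (hv : ContDiff ℝ ∞ v) (hdiv : VectorCalculus.IsDivFree v) {M B : ℝ}
    (hM : ∀ x, ‖v x‖ ≤ M) (hB : ∀ x, ‖fderiv ℝ v x‖ ≤ B) (h0 : ∫⁻ x, ‖iteratedFDeriv ℝ 0 v x‖ₑ ^ 2 < ⊤)
    (h1 : ∫⁻ x, ‖iteratedFDeriv ℝ 1 v x‖ₑ ^ 2 < ⊤) (h2 : ∫⁻ x, ‖iteratedFDeriv ℝ 2 v x‖ₑ ^ 2 < ⊤)
    (hpos : 0 < M * Real.sqrt (∫ x, ‖curl v x‖ ^ 2) * Real.sqrt (∫ x, frobeniusNormSq (fderiv ℝ (curl v) x)))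
    (hatt : |∫ x, ⟪curl v x, fderiv ℝ v x (curl v x)⟫| =
      sInf {κ : ℝ | (∀ (v : EuclideanSpace ℝ (Fin 3) → EuclideanSpace ℝ (Fin 3)) (M B : ℝ), ContDiff ℝ (⊤ : ℕ∞) v → Literature.Analysis.FluidPDE.VectorCalculus.IsDivFree v → (∀ x, ‖v x‖ ≤ M) → (∀ x, ‖fderiv ℝ v x‖ ≤ B) → (∫⁻ x, ‖iteratedFDeriv ℝ 0 v x‖ₑ ^ 2 < ⊤) → (∫⁻ x, ‖iteratedFDeriv ℝ 1 v x‖ₑ ^ 2 < ⊤) → (∫⁻ x, ‖iteratedFDeriv ℝ 2 v x‖ₑ ^ 2 < ⊤) → |∫ x, ⟪Literature.Analysis.FluidPDE.curl v x, fderiv ℝ v x (Literature.Analysis.FluidPDE.curl v x)⟫_ℝ| ≤ κ * M * Real.sqrt (∫ x, ‖Literature.Analysis.FluidPDE.curl v x‖ ^ 2) * Real.sqrt (∫ x, Literature.Analysis.FluidPDE.frobeniusNormSq (fderiv ℝ (Literature.Analysis.FluidPDE.curl v) x)))} * M * Real.sqrt (∫ x, ‖curl v x‖ ^ 2) *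
        Real.sqrt (∫ x, frobeniusNormSq (fderiv ℝ (curl v) x))) :
    (interior {x | ‖v x‖ = M}).Nonempty := by
  -- the constants
  have hK : 0 < sInf {κ : ℝ | (∀ (v : EuclideanSpace ℝ (Fin 3) → EuclideanSpace ℝ (Fin 3)) (M B : ℝ), ContDiff ℝ (⊤ : ℕ∞) v → Literature.Analysis.FluidPDE.VectorCalculus.IsDivFree v → (∀ x, ‖v x‖ ≤ M) → (∀ x, ‖fderiv ℝ v x‖ ≤ B) → (∫⁻ x, ‖iteratedFDeriv ℝ 0 v x‖ₑ ^ 2 < ⊤) → (∫⁻ x, ‖iteratedFDeriv ℝ 1 v x‖ₑ ^ 2 < ⊤) → (∫⁻ x, ‖iteratedFDeriv ℝ 2 v x‖ₑ ^ 2 < ⊤) → |∫ x, ⟪Literature.Analysis.FluidPDE.curl v x, fderiv ℝ v x (Literature.Analysis.FluidPDE.curl v x)⟫_ℝ| ≤ κ * M * Real.sqrt (∫ x, ‖Literature.Analysis.FluidPDE.curl v x‖ ^ 2) * Real.sqrt (∫ x, Literature.Analysis.FluidPDE.frobeniusNormSq (fderiv ℝ (Literature.Analysis.FluidPDE.curl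 v) x)))} := lt_trans (by norm_num) sharpDepletion_gt
  have hM0 : 0 ≤ M := (norm_nonneg _).trans (hM 0)
  have hZ0 : 0 ≤ ∫ x, ‖curl v x‖ ^ 2 := integral_nonneg fun x => sq_nonneg _
  have hW0 : 0 ≤ ∫ x, frobeniusNormSq (fderiv ℝ (curl v) x) := integral_nonneg fun x => frobeniusNormSq_nonneg _
  have hMpos : 0 < M := by
    rcases hM0.eq_or_lt with h | h
    · rw [← h, zero_mul, zero_mul] at hpos; exact absurd hpos (lt_irrefl _)
    · exact h
  have hZpos : 0 < ∫ x, ‖curl v x‖ ^ 2 := by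
    rcases hZ0.eq_or_lt with h | h
    · rw [← h, Real.sqrt_zero, mul_zero, zero_mul] at hpos; exact absurd hpos (lt_irrefl _)
    · exact h
  have hWpos : 0 < ∫ x, frobeniusNormSq (fderiv ℝ (curl v) x) := by
    rcases hW0.eq_or_lt with h | h
    · rw [← h, Real.sqrt_zero, mul_zero] at hpos; exact absurd hpos (lt_irrefl _)
    · exact h
  by_contra hne
  rw [not_nonempty_iff_eq_empty, interior_eq_empty_iff_dense_compl] at hne
  have hUeq : ({x | ‖v x‖ = M} : Set (EuclideanSpace ℝ (Fin 3)))ᶜ = {x | ‖v x‖ < M} := by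
    ext x
    simp only [mem_compl_iff, mem_setOf_eq]
    exact ⟨fun h => lt_of_le_of_ne (hM x) h, fun h => ne_of_lt h⟩
  rw [hUeq] at hne
  have hUo : IsOpen {x | ‖v x‖ < M} := isOpen_lt (continuous_norm.comp hv.continuous) continuous_const
  -- the continuous density of `ℓ ∘ curl`
  obtain ⟨G, hGc, hG⟩ := exists_density hv (∫ x, ⟪curl v x, fderiv ℝ v x (curl v x)⟫) (-(sInf {κ : ℝ | (∀ (v : EuclideanSpace ℝ (Fin 3) → EuclideanSpace ℝ (Fin 3)) (M B : ℝ), ContDiff ℝ (⊤ : ℕ∞) v → Literature.Analysis.FluidPDE.VectorCalculus.IsDivFree v → (∀ x, ‖v x‖ ≤ M) → (∀ x, ‖fderiv ℝ v x‖ ≤ B) → (∫⁻ x, ‖iteratedFDeriv ℝ 0 v x‖ₑ ^ 2 < ⊤) → (∫⁻ x, ‖iteratedFDeriv ℝ 1 v x‖ₑ ^ 2 < ⊤) → (∫⁻ x, ‖iteratedFDeriv ℝ 2 v x‖ₑ ^ 2 < ⊤) → |∫ x, ⟪Literature.Analysis.FluidPDE.curl v x, fderiv ℝ v x (Literature.Analysis.FluidPDE.curl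 v x)⟫_ℝ| ≤ κ * M * Real.sqrt (∫ x, ‖Literature.Analysis.FluidPDE.curl v x‖ ^ 2) * Real.sqrt (∫ x, Literature.Analysis.FluidPDE.frobeniusNormSq (fderiv ℝ (Literature.Analysis.FluidPDE.curl v) x)))} ^ 2 * M ^ 2 * (∫ x, frobeniusNormSq (fderiv ℝ (curl v) x)))) (-(sInf {κ : ℝ | (∀ (v : EuclideanSpace ℝ (Fin 3) → EuclideanSpace ℝ (Fin 3)) (M B : ℝ), ContDiff ℝ (⊤ : ℕ∞) v → Literature.Analysis.FluidPDE.VectorCalculus.IsDivFree v → (∀ x, ‖v x‖ ≤ M) → (∀ x, ‖fderiv ℝ v x‖ ≤ B) → (∫⁻ x, ‖iteratedFDeriv ℝ 0 v x‖ₑ ^ 2 < ⊤) → (∫⁻ x, ‖iteratedFDeriv ℝ 1 v x‖ₑ ^ 2 < ⊤) → (∫⁻ x, ‖iteratedFDeriv ℝ 2 v x‖ₑ ^ 2 < ⊤) → |∫ x, ⟪Literature.Analysis.FluidPDE.curl v x, fderiv ℝ v x (Literature.Analysis.FluidPDE.curl v x)⟫_ℝ| ≤ κ * M * Real.sqrt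 (∫ x, ‖Literature.Analysis.FluidPDE.curl v x‖ ^ 2) * Real.sqrt (∫ x, Literature.Analysis.FluidPDE.frobeniusNormSq (fderiv ℝ (Literature.Analysis.FluidPDE.curl v) x)))} ^ 2 * M ^ 2 * (∫ x, ‖curl v x‖ ^ 2)))
  -- `ℓ(curl η)` in terms of `G`, and `= 0` when `tsupport η ⊆ {‖v‖ < M}`
  have hℓ : ∀ η : EuclideanSpace ℝ (Fin 3) → EuclideanSpace ℝ (Fin 3), ContDiff ℝ ∞ η → HasCompactSupport η →
      (∫ x, ⟪curl v x, fderiv ℝ v x (curl v x)⟫) * (∫ x, (⟪curl (curl η) x, fderiv ℝ v x (curl v x)⟫ + ⟪curl v x, fderiv ℝ (curl η) x (curl v x)⟫ +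
          ⟪curl v x, fderiv ℝ v x (curl (curl η) x)⟫)) - sInf {κ : ℝ | (∀ (v : EuclideanSpace ℝ (Fin 3) → EuclideanSpace ℝ (Fin 3)) (M B : ℝ), ContDiff ℝ (⊤ : ℕ∞) v → Literature.Analysis.FluidPDE.VectorCalculus.IsDivFree v → (∀ x, ‖v x‖ ≤ M) → (∀ x, ‖fderiv ℝ v x‖ ≤ B) → (∫⁻ x, ‖iteratedFDeriv ℝ 0 v x‖ₑ ^ 2 < ⊤) → (∫⁻ x, ‖iteratedFDeriv ℝ 1 v x‖ₑ ^ 2 < ⊤) → (∫⁻ x, ‖iteratedFDeriv ℝ 2 v x‖ₑ ^ 2 < ⊤) → |∫ x, ⟪Literature.Analysis.FluidPDE.curl v x, fderiv ℝ v x (Literature.Analysis.FluidPDE.curl v x)⟫_ℝ| ≤ κ * M * Real.sqrt (∫ x, ‖Literature.Analysis.FluidPDE.curl v x‖ ^ 2) * Real.sqrt (∫ x, Literature.Analysis.FluidPDE.frobeniusNormSq (fderiv ℝ (Literature.Analysis.FluidPDE.curl v) x)))} ^ 2 * M ^ 2 * ((∫ x, frobeniusNormSq (fderiv ℝ (curl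 v) x)) * (∫ x, ⟪curl v x, curl (curl η) x⟫) + (∫ x, ‖curl v x‖ ^ 2) * (∫ x, ∑ i, ⟪fderiv ℝ (curl v) x (EuclideanSpace.basisFun (Fin 3) ℝ i),
          fderiv ℝ (curl (curl η)) x (EuclideanSpace.basisFun (Fin 3) ℝ i)⟫)) = ∫ x, ⟪G x, η x⟫ := by
    intro η hη hηc
    rw [← hG η hη hηc]
    ring
  have hℓ0 : ∀ η : EuclideanSpace ℝ (Fin 3) → EuclideanSpace ℝ (Fin 3), ContDiff ℝ ∞ η → HasCompactSupport η →
      tsupport η ⊆ {x | ‖v x‖ < M} → ∫ x, ⟪G x, η x⟫ = 0 := by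
    intro η hη hηc hηU
    have hcη : ContDiff ℝ ∞ (curl η) := contDiff_curl_top hη
    have h := firstVariation_eq_zero_offContact (φ := curl η) hv hdiv hM hB h0 h1 h2 hatt hcη
      (hasCompactSupport_curl hηc) (fun x => divergence_curl_eq_zero_holds η (hη.of_le (by norm_cast)) x)
      ((tsupport_curl_subset η).trans hηU)
    rw [← hℓ η hη hηc, h]
    ring
  -- `G = 0` a.e. on `{‖v‖ < M}`, hence on it, hence everywhere
  have hGae : ∀ᵐ x ∂(volume : Measure (EuclideanSpace ℝ (Fin 3))), x ∈ {x | ‖v x‖ < M} → G x = 0 := by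
    refine hUo.ae_eq_zero_of_integral_contDiff_smul_eq_zero (hGc.locallyIntegrable.locallyIntegrableOn _)
      fun θ hθ hθc hθU => ?_
    have hint : Integrable (fun x => θ x • G x) (volume : Measure (EuclideanSpace ℝ (Fin 3))) :=
      (hθ.continuous.smul hGc).integrable_of_hasCompactSupport hθc.smul_right
    refine ext_inner_left ℝ fun e => ?_
    rw [inner_zero_right, ← integral_inner hint e]
    have hη : ContDiff ℝ ∞ fun x => θ x • e := hθ.smul contDiff_const
    have hηc : HasCompactSupport fun x => θ x • e := hθc.smul_right
    have hηU : tsupport (fun x => θ x • e) ⊆ {x | ‖v x‖ < M} := (tsupport_smul_subset_left _ _).trans hθU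
    have hpt : ∀ x, ⟪e, θ x • G x⟫ = ⟪G x, θ x • e⟫ := fun x => by
      rw [inner_smul_right, inner_smul_right, real_inner_comm]
    rw [integral_congr_ae (Eventually.of_forall hpt)]
    exact hℓ0 _ hη hηc hηU
  have hGU : EqOn G 0 {x | ‖v x‖ < M} :=
    Measure.eqOn_open_of_ae_eq ((ae_restrict_iff' hUo.measurableSet).2 hGae) hUo hGc.continuousOn
      continuousOn_const
  have hG0 : G = 0 := Continuous.ext_on hne hGc continuous_const hGU
  -- the cut-off perturbation `φ_R = curl (χ · conePotential v)`
  obtain ⟨R, hR0, hR⟩ := exists_radius_norm_lt hv hB h0 (half_pos hMpos)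
  let χ : ContDiffBump (0 : EuclideanSpace ℝ (Fin 3)) := ⟨R + 1, R + 2, by linarith, by linarith⟩
  obtain ⟨hφ, hφc, hφdiv, -⟩ := cutoff_field hv hdiv χ
  obtain ⟨ε₀, hε₀, hbound⟩ := exists_normBound_cutoff hv hdiv hM hMpos hR χ (by
    show R < R + 1
    linarith)
  have hm1 := firstVariation_eq_of_normBound hv hdiv hB h0 h1 h2 hatt hφ hφc hφdiv hε₀ hbound
  have hη : ContDiff ℝ ∞ fun y => χ y • conePotential v y := χ.contDiff.smul (contDiff_conePotential hv)
  have hηc : HasCompactSupport fun y => χ y • conePotential v y := χ.hasCompactSupport.smul_right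
  have hℓR := hℓ _ hη hηc
  rw [hG0] at hℓR
  simp only [Pi.zero_apply, inner_zero_left, integral_zero] at hℓR
  rw [hm1] at hℓR
  have : sInf {κ : ℝ | (∀ (v : EuclideanSpace ℝ (Fin 3) → EuclideanSpace ℝ (Fin 3)) (M B : ℝ), ContDiff ℝ (⊤ : ℕ∞) v → Literature.Analysis.FluidPDE.VectorCalculus.IsDivFree v → (∀ x, ‖v x‖ ≤ M) → (∀ x, ‖fderiv ℝ v x‖ ≤ B) → (∫⁻ x, ‖iteratedFDeriv ℝ 0 v x‖ₑ ^ 2 < ⊤) → (∫⁻ x, ‖iteratedFDeriv ℝ 1 v x‖ₑ ^ 2 < ⊤) → (∫⁻ x, ‖iteratedFDeriv ℝ 2 v x‖ₑ ^ 2 < ⊤) → |∫ x, ⟪Literature.Analysis.FluidPDE.curl v x, fderiv ℝ v x (Literature.Analysis.FluidPDE.curl v x)⟫_ℝ| ≤ κ * M * Real.sqrt (∫ x, ‖Literature.Analysis.FluidPDE.curl v x‖ ^ 2) * Real.sqrt (∫ x, Literature.Analysis.FluidPDE.frobeniusNormSq (fderiv ℝ (Literature.Analysis.FluidPDE.curl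 v) x)))} ^ 2 * M ^ 2 * ((∫ x, ‖curl v x‖ ^ 2) * (∫ x, frobeniusNormSq (fderiv ℝ (curl v) x))) = 0 := by linear_combination hℓR
  have hprod : 0 < sInf {κ : ℝ | (∀ (v : EuclideanSpace ℝ (Fin 3) → EuclideanSpace ℝ (Fin 3)) (M B : ℝ), ContDiff ℝ (⊤ : ℕ∞) v → Literature.Analysis.FluidPDE.VectorCalculus.IsDivFree v → (∀ x, ‖v x‖ ≤ M) → (∀ x, ‖fderiv ℝ v x‖ ≤ B) → (∫⁻ x, ‖iteratedFDeriv ℝ 0 v x‖ₑ ^ 2 < ⊤) → (∫⁻ x, ‖iteratedFDeriv ℝ 1 v x‖ₑ ^ 2 < ⊤) → (∫⁻ x, ‖iteratedFDeriv ℝ 2 v x‖ₑ ^ 2 < ⊤) → |∫ x, ⟪Literature.Analysis.FluidPDE.curl v x, fderiv ℝ v x (Literature.Analysis.FluidPDE.curl v x)⟫_ℝ| ≤ κ * M * Real.sqrt (∫ x, ‖Literature.Analysis.FluidPDE.curl v x‖ ^ 2) * Real.sqrt (∫ x, Literature.Analysis.FluidPDE.frobeniusNormSq (fderiv ℝ (Literature.Analysis.FluidPDE.curl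 v) x)))} ^ 2 * M ^ 2 * ((∫ x, ‖curl v x‖ ^ 2) * (∫ x, frobeniusNormSq (fderiv ℝ (curl v) x))) := by positivity
  exact absurd this hprod.ne'

/-- **NO REAL-ANALYTIC ADMISSIBLE FIELD |∫ x, ⟪curl v x, fderiv ℝ v x (curl v x)⟫| =
      sInf {κ : ℝ | (∀ (v : EuclideanSpace ℝ (Fin 3) → EuclideanSpace ℝ (Fin 3)) (M B : ℝ), ContDiff ℝ (⊤ : ℕ∞) v → Literature.Analysis.FluidPDE.VectorCalculus.IsDivFree v → (∀ x, ‖v x‖ ≤ M) → (∀ x, ‖fderiv ℝ v x‖ ≤ B) → (∫⁻ x, ‖iteratedFDeriv ℝ 0 v x‖ₑ ^ 2 < ⊤) → (∫⁻ x, ‖iteratedFDeriv ℝ 1 v x‖ₑ ^ 2 < ⊤) → (∫⁻ x, ‖iteratedFDeriv ℝ 2 v x‖ₑ ^ 2 < ⊤) → |∫ x, ⟪Literature.Analysis.FluidPDE.curl v x, fderiv ℝ v x (Literature.Analysis.FluidPDE.curl v x)⟫_ℝ| ≤ κ * M * Real.sqrt (∫ x, ‖Literature.Analysis.FluidPDE.curl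 v x‖ ^ 2) * Real.sqrt (∫ x, Literature.Analysis.FluidPDE.frobeniusNormSq (fderiv ℝ (Literature.Analysis.FluidPDE.curl v) x)))} * M * Real.sqrt (∫ x, ‖curl v x‖ ^ 2) *
        Real.sqrt (∫ x, frobeniusNormSq (fderiv ℝ (curl v) x))AINS `κ⋆`.** If `v` is moreover real analytic on `ℝ³` (as every
polynomial-Gaussian witness of the tree is), then `(v, M, B)` does not attain the sharp constant: on the
plateau given by `interior_contact_nonempty` the analytic function `‖v‖²` is constant `= M²`, hence constant
on all of `ℝ³` by the identity principle, contradicting the decay of an `L²` Lipschitz field. [folklore] -/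
theorem not_attained_of_analyticOnNhd (hv : ContDiff ℝ ∞ v) (han : AnalyticOnNhd ℝ v univ)
    (hdiv : VectorCalculus.IsDivFree v) {M B : ℝ}
    (hM : ∀ x, ‖v x‖ ≤ M) (hB : ∀ x, ‖fderiv ℝ v x‖ ≤ B) (h0 : ∫⁻ x, ‖iteratedFDeriv ℝ 0 v x‖ₑ ^ 2 < ⊤)
    (h1 : ∫⁻ x, ‖iteratedFDeriv ℝ 1 v x‖ₑ ^ 2 < ⊤) (h2 : ∫⁻ x, ‖iteratedFDeriv ℝ 2 v x‖ₑ ^ 2 < ⊤)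
    (hpos : 0 < M * Real.sqrt (∫ x, ‖curl v x‖ ^ 2) * Real.sqrt (∫ x, frobeniusNormSq (fderiv ℝ (curl v) x))) :
    |∫ x, ⟪curl v x, fderiv ℝ v x (curl v x)⟫| ≠
      sInf {κ : ℝ | (∀ (v : EuclideanSpace ℝ (Fin 3) → EuclideanSpace ℝ (Fin 3)) (M B : ℝ), ContDiff ℝ (⊤ : ℕ∞) v → Literature.Analysis.FluidPDE.VectorCalculus.IsDivFree v → (∀ x, ‖v x‖ ≤ M) → (∀ x, ‖fderiv ℝ v x‖ ≤ B) → (∫⁻ x, ‖iteratedFDeriv ℝ 0 v x‖ₑ ^ 2 < ⊤) → (∫⁻ x, ‖iteratedFDeriv ℝ 1 v x‖ₑ ^ 2 < ⊤) → (∫⁻ x, ‖iteratedFDeriv ℝ 2 v x‖ₑ ^ 2 < ⊤) → |∫ x, ⟪Literature.Analysis.FluidPDE.curl v x, fderiv ℝ v x (Literature.Analysis.FluidPDE.curl v x)⟫_ℝ| ≤ κ * M * Real.sqrt (∫ x, ‖Literature.Analysis.FluidPDE.curl v x‖ ^ 2) * Real.sqrt (∫ x, Literature.Analysis.FluidPDE.frobeniusNormSq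 (fderiv ℝ (Literature.Analysis.FluidPDE.curl v) x)))} * M * Real.sqrt (∫ x, ‖curl v x‖ ^ 2) *
        Real.sqrt (∫ x, frobeniusNormSq (fderiv ℝ (curl v) x)) := by
  intro hatt
  obtain ⟨x₀, hx₀⟩ := interior_contact_nonempty hv hdiv hM hB h0 h1 h2 hpos hatt
  have hM0 : 0 ≤ M := (norm_nonneg _).trans (hM 0)
  have hMpos : 0 < M := by
    rcases hM0.eq_or_lt with h | h
    · rw [← h, zero_mul, zero_mul] at hpos; exact absurd hpos (lt_irrefl _)
    · exact h
  -- `‖v‖² = Σᵢ vᵢ²` is analytic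
  have hsq : AnalyticOnNhd ℝ (fun x => ‖v x‖ ^ 2) univ := by
    have hcoord : ∀ i : Fin 3, AnalyticOnNhd ℝ (fun x => v x i) univ := fun i =>
      (EuclideanSpace.proj i : EuclideanSpace ℝ (Fin 3) →L[ℝ] ℝ).comp_analyticOnNhd han
    have heq : (fun x => ‖v x‖ ^ 2) = fun x => ∑ i, v x i * v x i := by
      funext x
      rw [EuclideanSpace.norm_eq, Real.sq_sqrt (Finset.sum_nonneg fun i _ => sq_nonneg _)]
      exact Finset.sum_congr rfl fun i _ => by rw [Real.norm_eq_abs, sq_abs, sq]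
    rw [heq]
    exact Finset.analyticOnNhd_fun_sum _ fun i _ => (hcoord i).mul (hcoord i)
  -- constant near `x₀`, hence everywhere
  have hev : (fun x => ‖v x‖ ^ 2) =ᶠ[𝓝 x₀] fun _ => M ^ 2 := by
    filter_upwards [mem_interior_iff_mem_nhds.1 hx₀] with x hx
    have hx' : ‖v x‖ = M := hx
    rw [hx']
  have hconst : (fun x => ‖v x‖ ^ 2) = fun _ => M ^ 2 := hsq.eq_of_eventuallyEq analyticOnNhd_const hev
  -- contradiction with decay
  obtain ⟨R, -, hR⟩ := exists_radius_norm_lt hv hB h0 hMpos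
  obtain ⟨x, hx⟩ := NormedSpace.exists_lt_norm ℝ (EuclideanSpace ℝ (Fin 3)) R
  have h1' := hR x hx.le
  have h2' : ‖v x‖ ^ 2 = M ^ 2 := congrFun hconst x
  nlinarith [norm_nonneg (v x)]

/-! ## In the item's own words -/

/-- **`KStarAttained` ⇒ the witness has a speed plateau and is not real analytic.** If the sharp depletion
constant is attained on the admissible class (the statement of item stmt-NavierStokesRegularity-24370, verbatim as
hypothesis), then some admissible non-degenerate field `v` with bound `M` attains it AND satisfies: `‖v‖ ≡ M` on a
nonempty open set, and `v` is not real analytic on `ℝ³`. (Repackaging of `interior_contact_nonempty` and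
`not_attained_of_analyticOnNhd`; it does not decide the item.) [folklore] -/
theorem plateau_of_kStarAttained
    (h : ∃ (v : EuclideanSpace ℝ (Fin 3) → EuclideanSpace ℝ (Fin 3)) (M B : ℝ), ContDiff ℝ (⊤ : ℕ∞) v ∧ Literature.Analysis.FluidPDE.VectorCalculus.IsDivFree v ∧ (∀ x, ‖v x‖ ≤ M) ∧ (∀ x, ‖fderiv ℝ v x‖ ≤ B) ∧ (∫⁻ x, ‖iteratedFDeriv ℝ 0 v x‖ₑ ^ 2 < ⊤) ∧ (∫⁻ x, ‖iteratedFDeriv ℝ 1 v x‖ₑ ^ 2 < ⊤) ∧ (∫⁻ x, ‖iteratedFDeriv ℝ 2 v x‖ₑ ^ 2 < ⊤) ∧ 0 < M * Real.sqrt (∫ x, ‖Literature.Analysis.FluidPDE.curl v x‖ ^ 2) * Real.sqrt (∫ x, Literature.Analysis.FluidPDE.frobeniusNormSq (fderiv ℝ (Literature.Analysis.FluidPDE.curl v) x)) ∧ |∫ x, ⟪Literature.Analysis.FluidPDE.curl v x, fderiv ℝ v x (Literature.Analysis.FluidPDE.curl v x)⟫_ℝ| = sInf {κ : ℝ | (∀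 (v : EuclideanSpace ℝ (Fin 3) → EuclideanSpace ℝ (Fin 3)) (M B : ℝ), ContDiff ℝ (⊤ : ℕ∞) v → Literature.Analysis.FluidPDE.VectorCalculus.IsDivFree v → (∀ x, ‖v x‖ ≤ M) → (∀ x, ‖fderiv ℝ v x‖ ≤ B) → (∫⁻ x, ‖iteratedFDeriv ℝ 0 v x‖ₑ ^ 2 < ⊤) → (∫⁻ x, ‖iteratedFDeriv ℝ 1 v x‖ₑ ^ 2 < ⊤) → (∫⁻ x, ‖iteratedFDeriv ℝ 2 v x‖ₑ ^ 2 < ⊤) → |∫ x, ⟪Literature.Analysis.FluidPDE.curl v x, fderiv ℝ v x (Literature.Analysis.FluidPDE.curl v x)⟫_ℝ| ≤ κ * M * Real.sqrt (∫ x, ‖Literature.Analysis.FluidPDE.curl v x‖ ^ 2) * Real.sqrt (∫ x, Literature.Analysis.FluidPDE.frobeniusNormSq (fderiv ℝ (Literature.Analysis.FluidPDE.curl v) x)))} * M * Real.sqrt (∫ x, ‖Literature.Analysis.FluidPDE.curl v x‖ ^ 2) * Real.sqrt (∫ x, Literature.Analysis.FluidPDE.frobeniusNormSq (fderiv ℝ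 (Literature.Analysis.FluidPDE.curl v) x))) :
    ∃ (v : EuclideanSpace ℝ (Fin 3) → EuclideanSpace ℝ (Fin 3)) (M B : ℝ), ContDiff ℝ (⊤ : ℕ∞) v ∧
      Literature.Analysis.FluidPDE.VectorCalculus.IsDivFree v ∧ (∀ x, ‖v x‖ ≤ M) ∧ (∀ x, ‖fderiv ℝ v x‖ ≤ B) ∧
      0 < M * Real.sqrt (∫ x, ‖curl v x‖ ^ 2) * Real.sqrt (∫ x, frobeniusNormSq (fderiv ℝ (curl v) x)) ∧
      |∫ x, ⟪curl v x, fderiv ℝ v x (curl v x)⟫| =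
        sInf {κ : ℝ | (∀ (v : EuclideanSpace ℝ (Fin 3) → EuclideanSpace ℝ (Fin 3)) (M B : ℝ), ContDiff ℝ (⊤ : ℕ∞) v → Literature.Analysis.FluidPDE.VectorCalculus.IsDivFree v → (∀ x, ‖v x‖ ≤ M) → (∀ x, ‖fderiv ℝ v x‖ ≤ B) → (∫⁻ x, ‖iteratedFDeriv ℝ 0 v x‖ₑ ^ 2 < ⊤) → (∫⁻ x, ‖iteratedFDeriv ℝ 1 v x‖ₑ ^ 2 < ⊤) → (∫⁻ x, ‖iteratedFDeriv ℝ 2 v x‖ₑ ^ 2 < ⊤) → |∫ x, ⟪Literature.Analysis.FluidPDE.curl v x, fderiv ℝ v x (Literature.Analysis.FluidPDE.curl v x)⟫_ℝ| ≤ κ * M * Real.sqrt (∫ x, ‖Literature.Analysis.FluidPDE.curl v x‖ ^ 2) * Real.sqrt (∫ x, Literature.Analysis.FluidPDE.frobeniusNormSq (fderiv ℝ (Literature.Analysis.FluidPDE.curl v) x)))} * M * Real.sqrt (∫ x, ‖curl v x‖ ^ 2) * Real.sqrt (∫ x, frobeniusNormSq (fderiv ℝ (curl v) x)) ∧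
      (interior {x | ‖v x‖ = M}).Nonempty ∧ ¬ AnalyticOnNhd ℝ v univ := by
  obtain ⟨v, M, B, hv, hdiv, hM, hB, h0, h1, h2, hpos, hatt⟩ := h
  exact ⟨v, M, B, hv, hdiv, hM, hB, hpos, hatt, interior_contact_nonempty hv hdiv hM hB h0 h1 h2 hpos hatt,
    fun han => not_attained_of_analyticOnNhd hv han hdiv hM hB h0 h1 h2 hpos hatt⟩

end DepletionLadder.KStar

end Summit.NavierStokesRegularity.NavierStokesRegularity.Theorems

end
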